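import Literature.AnabelianGeometry.EtaleTheta.MonoThetaEnv

/-!
# [EtTh] Remark 2.19.2, the contrast at the FIRST power: an automorphism of a model mono-theta
# environment that raises the theta section to a power `λ` forces `η^λ ≡ η` (cyclotomic rigidity)

Mochizuki, *The Étale Theta Function and its Frobenioid-theoretic Manifestations* [EtTh],
Publ. RIMS 45 (2009), §2, Remark 2.19.2 p.67 and Cor 2.19 (i) p.64 (locator `p.N` = PDF page of the
PRIMS text; bib key `MochizukiEtTh2009`). PROOF-ONLY companion (no `def`; seat abc-iut-L2-t2, §2 owner)
of `MonoThetaEnv.lean` and of `MonoThetaEnvPowers.lean` (the `M`-th-power environments `powMono`, whose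
power automorphisms `powAut λ`, `a^{Mλ} = a^M`, exhibit the NON-rigidity of `μ_N ∖ M·μ_N` for `M > 1`).

Here the `M = 1` side of the contrast, stated over `ThetaEnvData` without reference to `powAut` (so it
applies to it through `powAut_apply`): if an automorphism `α` of the MODEL mono-theta environment
`M(η) = (Π^tp_Y[μ_N], D_Y, [Im s^Θ_η])` acts on the theta section by `s^Θ_η(g) = (η(g)⁻¹, g) ↦
(η(g)^{−λ}, g)` (as the power map `(a, g) ↦ (a^λ, g)` does), then `η^λ = η · ∂c` for some `c ∈ μ_N` —
i.e. `λ` fixes the CLASS of `η`; since on `l·Δ_Θ` the theta cocycle is the identification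
`(l·Δ_Θ) ⊗ ℤ/N ≅ μ_N` (Cor 2.19 (i); `RigidData.cocycle_lDeltaTheta`), this is `λ ≡ 1 (mod N)`: the genuine
(first-power) environment admits no cyclotome indeterminacy. HONEST FRAMING: elementary group theory of
the model data; no side is taken on [IUTchIII] Cor 3.12.
-/

noncomputable section

namespace Literature.AnabelianGeometry.EtaleTheta

universe u

namespace ThetaEnvData

variable {N : ℕ+} (T : ThetaEnvData.{u} N)

/-- Conjugation by an element of the cyclotome does not move the `Π^tp_Y`-coordinate.
[cite: MochizukiEtTh2009, Def 2.10 p.44] -/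
theorem right_conj_inMu (a : T.mu) (x : T.env) :
    (MulAut.conj (CycEnvelope.inMu T.augY T.chi a) x).right = x.right := by
  rw [CycEnvelope.conj_inMu_eq_shift_coboundary]
  rfl

/-- **Rmk 2.19.2 / Cor 2.19 (i), the first-power contrast**: if an automorphism `α` of the model
mono-theta environment `M(η)` maps `s^Θ_η(g) = (η(g)⁻¹, g)` to `(η(g)^{−λ}, g)` for every `g ∈ Π^tp_Ÿ`,
then `η^λ = η · ∂c` for some `c ∈ μ_N` (because `α` must carry `Im s^Θ_η` to a `μ_N`-CONJUGATE of
itself, and "conjugation by an element of `μ_N` corresponds precisely to modifying a cocycle by a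
coboundary", p.47). [cite: MochizukiEtTh2009, Rmk 2.19.2 p.67] -/
theorem pow_eq_mul_coboundary_of_iso_pow {η : T.PiYdd → T.mu} (hη : η ∈ T.thetaCocycles) (n : ℕ)
    (α : (T.modelMono hη).Iso (T.modelMono hη))
    (hα : ∀ g : T.PiYdd, α.e (T.sTheta hη g) = ⟨((η g)⁻¹) ^ n, T.inclYdd g⟩) :
    ∃ c : T.mu, η ^ n = η * CycEnvelope.coboundary (T.aug.comp T.PiYdd.subtype) T.chi c := by
  -- `α` carries `Im s^Θ_η` into the `μ_N`-conjugacy class of `Im s^Θ_η`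
  have hmem : (T.sTheta hη).range.map α.e.toMulEquiv.toMonoidHom ∈
      CycEnvelope.muConjClass T.augY T.chi (T.sTheta hη).range := by
    have h := α.map_sTheta
    change (fun H : Subgroup T.env => H.map α.e.toMulEquiv.toMonoidHom) ''
        CycEnvelope.muConjClass T.augY T.chi (T.sTheta hη).range =
      CycEnvelope.muConjClass T.augY T.chi (T.sTheta hη).range at h
    rw [← h]
    exact ⟨_, CycEnvelope.self_mem_muConjClass T.augY T.chi _, rfl⟩
  obtain ⟨a, ha⟩ := hmem
  refine ⟨a⁻¹, funext fun g => ?_⟩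
  -- `α (s^Θ g) = conj(a) (s^Θ g')` for some `g'`, and `g' = g` by projecting to `Π^tp_Y`
  have hg : α.e (T.sTheta hη g) ∈ (T.sTheta hη).range.map
      (MulAut.conj (CycEnvelope.inMu T.augY T.chi a)).toMonoidHom := by
    rw [← ha]; exact ⟨T.sTheta hη g, ⟨g, rfl⟩, rfl⟩
  obtain ⟨_, ⟨g', rfl⟩, hgg'⟩ := hg
  have hright : T.inclYdd g' = T.inclYdd g := by
    have h1 := congrArg SemidirectProduct.right hgg'
    rw [MulEquiv.coe_toMonoidHom, T.right_conj_inMu, hα] at h1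
    exact h1
  have hg' : g' = g := Subgroup.inclusion_injective T.PiYdd_le hright
  subst hg'
  -- compare the `μ_N`-coordinates
  have hleft := congrArg SemidirectProduct.left hgg'
  rw [MulEquiv.coe_toMonoidHom, CycEnvelope.conj_inMu_eq_shift_coboundary, hα] at hleft
  change (η g')⁻¹ * CycEnvelope.coboundary T.augY T.chi a (T.inclYdd g') = ((η g')⁻¹) ^ n at hleft
  rw [Pi.pow_apply, Pi.mul_apply]
  apply inv_injective
  rw [← inv_pow, ← hleft, mul_inv, CycEnvelope.coboundary, CycEnvelope.coboundary, mul_inv, inv_inv,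
    map_inv, inv_inv]
  rfl

end ThetaEnvData

end Literature.AnabelianGeometry.EtaleTheta

end
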